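import Summits.ValiantsHypothesis.ValiantsHypothesis.Theses.FreeSubtorus
import Summits.ValiantsHypothesis.ValiantsHypothesis.Theorems.RigidMinimalRepsTorusBound
import Literature.Computability.AlgebraicComplexity.GrenetEquivariant
import Literature.Computability.AlgebraicComplexity.LandsbergRessayreNormalForm
import Literature.Computability.AlgebraicComplexity.FermionicPencil
import Literature.LinearAlgebra.Matrix.PermanentSubperm

/-!
# Disproof of `SubtorusCovering` — findings (standing disprover, cycle 1, 2026-08-17)

Crux `Summit.ValiantsHypothesis.ValiantsHypothesis.Theses.FreeSubtorus.SubtorusCovering`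
(stmt-ValiantsHypothesis-16134, route FreeSubtorus, rank 3): for `n ≥ 3`, every affine determinantal
representation `B` of `per_n` (size `m`) with exact `GL_m × GL_m` lifts of the subtorus
`T_Λ = closure {diag(d_k e_l) : ∏ d^{Λ_i∘inl} ∏ e^{Λ_i∘inr} = 1 ∀ i < r}`, `Λ` admissible (zero row- and
column-sums), has `C(n, ⌊n/2⌋) ≤ m · 2^r`.

**VERDICT OF THIS CYCLE: NO KILL — the crux is (very probably) TRUE, indeed in the stronger form
`(2^n - 2)/2^r ≤ m - 1`.**  Index of what this file checks (all sorry-free):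

* §0  `subtorusCovering_iff` — the decl restated through `torusGens` / `Admissible` (by `Iff.rfl`): no
  coercion or junk-operator surprises (`ℕ` only, no subtraction, `n / 2` = intended floor; `r` counts
  GENERATORS, so `r ≥ rank Λ` and redundant generators only weaken the claim).
* §A  LOAD-BEARING ANALYSIS (one `def …Without<H>` + `theorem …_false_without_<H>` per hypothesis):
  - `subtorusCovering_false_without_nGe` — the guard `3 ≤ n` dropped: false at `n = 0, m = 0`
    (`per_0 = 1 = det ∅`).  It is load-bearing ONLY at `n = 0`: at `n = 1, 2` the `C(n,⌊n/2⌋)`-form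
    holds (`1 ≤ m`, `2 ≤ m`); but see §B: the Grenet form the line actually proves fails at `n = 2`.
  - `subtorusCovering_false_without_affine` — affineness (`totalDegree ≤ 1`) dropped: false, the
    `1 × 1` matrix `(per_3)` is a `T_Λ`-equivariant determinantal expression of size 1 for EVERY `Λ`
    (lift `g = ∏d ∏e`, `h = 1`; `perOne_lifts`).  The covering count is a statement about degree-1 labels.
  - `subtorusCovering_false_for_detPoly` — `per_n` replaced by `det_n`: false, `A(X) = X` is fully
    torus-equivariant of size `n < C(n,⌊n/2⌋)` (`n = 5`: `10 ≤ 5` fails).  So the per-SPECIFIC input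
    (von zur Gathen regularity `rank B(0) = m - 1`; `X` is irregular, `X(0) = 0`) is load-bearing —
    exactly LR17's remark `edc_T(det_m) = m` (arXiv:1610.00159 p. 3).
  - `subtorusCoveringWithoutEquivariance_iff` — equivariance dropped (the `r = 0` reading): the
    statement becomes `∀ n ≥ 3, C(n,⌊n/2⌋) ≤ dc(per_n)`, an OPEN super-quadratic lower bound (best known
    `n²/2`, Mignon–Ressayre).  Not refutable, not provable here: equivariance is where the content is.
  - admissibility dropped: NO counterexample is constructible cheaply (a codimension-`r` subtorus still
    forces `m · 2^r < C(n,⌊n/2⌋) < 2^n - 1`, i.e. beating Grenet).  On paper only POINTEDNESS is used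
    by the dictionary (no non-zero `u ≥ 0` with `(rowsums u; colsums u) ∈ ℚΛ`), and the ROW half of
    admissibility already gives it; the column half is redundant (information for the prover; the
    registered skeleton `Lines/birth.lean` indeed consumes only `(hΛ i).1`).
* §B  NATURAL STRENGTHENINGS:
  - `not_grenetForm_without_nGe` — the Grenet form `2^n - 1 ≤ m · 2^r` WITHOUT the guard is false at
    `n = 2` (`perTwo = [[x₀₀, -x₁₀], [x₀₁, x₁₁]]`, size 2, fully torus-equivariant, irregular: `B(0) = 0`);
    with the guard it follows from the same covering argument summed over all levels.  So any proof of
    the strong form must use `n ≥ 3` through regularity, as LR17 Thm 2.8 does.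
  - `subtorusCovering_rank_zero` / `subtorusCovering_r_zero` — the `r = 0` slice is ALREADY A THEOREM
    (`RigidMinimalRepsTorusBound.torusBound_proof`, stmt-5114: `2^n - 1 ≤ m`), so no counterexample with
    `Λ` empty exists, and the crux's constant is far from tight there (`C(n,⌊n/2⌋)` vs `2^n - 1`, Grenet).
* §C  WHY IT RESISTS (paper proof, checked line by line; = the registered line `Lines/birth.lean`, whose
  three stubs I also checked TRUE on paper, junk instances `n = 0` / `m = 0` included):
  (1) a generic `t = (d,e) ∈ T_Λ°` has `χ(t) = 1 ⇔ χ ∈ Λ_sat` and, by the ROW half of admissibility, no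
  closed weight walk (`∏ c_p^{u_p} ≠ 1`, `u ≠ 0`, since `(rowsums u; colsums u)` has row-sum `|u| > 0`);
  (2) ONE exact lift `(g,h)` of `t` suffices: `B₀` maps `gen_h(μ) → gen_g(μ)`, `B_p` maps
  `gen_h(μ) → gen_g(c_p μ)` (generalised eigenspaces — non-semisimple / disconnected lifts are harmless);
  vzG (`vonzurGathen1987_perm_detRepr_rank_holds`, `n ≥ 3`) gives `rank B₀ = m - 1`, hence in adapted
  bases `B₀ = 0 ⊕ I_{m-1}` with row `i` and column `i` of the same weight (`i ≥ 2`); no closed walk ⇒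
  `B_ii = 1` exactly and the support digraph on `{2..m}` is acyclic ⇒ Leibniz = `B₁₁ +` signed sum over
  paths column-1 → row-1; (3) the coefficient of `x_σ` in `κ·per_n` is `κ ≠ 0`, so SOME length-`n` path
  spells `x_σ`; its `d`-th vertex has weight `γ₀ · (1_S; 1_{σ S})(t)`, `|S| = d` — SIGNS ARE IRRELEVANT
  (a non-zero sum has a non-zero term), so the docstring's "signed inclusion–exclusion" worry is void;
  (4) pairs `(S,T)` with equal value differ by an element of `ℚΛ` (exact separation), a translate of
  `ℚΛ` holds `≤ 2^{rank Λ} ≤ 2^r` hypercube points (Odlyzko 1988 p. 127), distinct values are distinct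
  eigenvalues of `g` (`≤ m`, in fact `≤ m - 1` internal at `0 < d < n`), a pair serves `d!(n-d)!`
  permutations: `n! ≤ (m-1) · 2^r · d!(n-d)!`.  Summing over `d = 1..n-1`: `(2^n - 2)/2^r ≤ m - 1`.
  CONSEQUENCE FOR A REFUTER: a counterexample needs `m · 2^r < C(n,⌊n/2⌋) < 2^n - 1` (`n ≥ 6` at
  `r = 0`, `n ≥ 8` at `r = 1`), i.e. a determinantal expression of `per_n` smaller than Grenet's —
  nothing of the kind is known for any `n`; no finite/decidable model exists (statement over `ℂ`).
* `-- Targets`: none this cycle (payload `stuck_stubs = []`; no `PICKED.md`).  Pre-attack notes on the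
  three `birth` stubs are in §C comments below.

LANDED under `Theorems/SubtorusCovering/Negative/` (importable, `--supports` this item; namespaces
`Summit.ValiantsHypothesis.Theorems.SubtorusCoveringNegative.{Guard,Affine,DetForm}`):
`FalseWithoutGuard.lean` (p159128: `subtorusCovering_false_without_guard`, `grenetForm_false_without_guard`),
`FalseWithoutAffine.lean` (p159179: `subtorusCovering_false_without_affine`, `lifts_of_generators`,
`linSubst_torus_perPoly`), `FalseForDet.lean` (p159243: `subtorusCovering_false_for_detPoly`,
`isEquivariantDetRepr_mvPolynomialX`).  This work file keeps its own copies (namespace `…Disproof`).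

Used from earlier seats: refuter R1 review / rattack briefing (same conclusion; their `Scratch16134.lean`
is not readable from this seat, the witnesses below are re-derived), `Lines/birth.lean` (stub shapes).
-/

open Literature.Computability.AlgebraicComplexity MvPolynomial Matrix

-- the mandated namespace repeats a component by design (single-conjunct summit)
set_option linter.dupNamespace false

noncomputable section

namespace Summit.ValiantsHypothesis.ValiantsHypothesis.Cruxes.SubtorusCovering.Disproof

/-! ## §0 The crux restated -/

/-- The generator set of the subtorus `T_Λ` — literally the set in the crux. [folklore] -/
def torusGens (n r : ℕ) (Λ : Fin r → (Fin n ⊕ Fin n) → ℤ) : Set (GL (Fin n × Fin n) ℂ) :=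
  {γ : Matrix.GeneralLinearGroup (Fin n × Fin n) ℂ | ∃ d e : Fin n → ℂˣ,
    (∀ i, (∏ k, (d k) ^ (Λ i (Sum.inl k))) * (∏ l, (e l) ^ (Λ i (Sum.inr l))) = 1) ∧
    (γ : Matrix (Fin n × Fin n) (Fin n × Fin n) ℂ) = Matrix.diagonal (fun p => (d p.1 : ℂ) * (e p.2 : ℂ))}

/-- Admissibility: zero row-sum and zero column-sum of every generator. [folklore] -/
def Admissible {n r : ℕ} (Λ : Fin r → (Fin n ⊕ Fin n) → ℤ) : Prop :=
  ∀ i, (∑ k, Λ i (Sum.inl k)) = 0 ∧ (∑ l, Λ i (Sum.inr l)) = 0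

/-- The crux, read back symbol by symbol (definitional). [folklore] -/
theorem subtorusCovering_iff :
    Summit.ValiantsHypothesis.ValiantsHypothesis.Theses.FreeSubtorus.SubtorusCovering ↔
    ∀ n : ℕ, 3 ≤ n → ∀ (m r : ℕ) (Λ : Fin r → (Fin n ⊕ Fin n) → ℤ)
      (B : Matrix (Fin m) (Fin m) (MvPolynomial (Fin n × Fin n) ℂ)), Admissible Λ →
      IsEquivariantDetRepr (Subgroup.closure (torusGens n r Λ)) (perPoly (Fin n) ℂ) B →
      Nat.choose n (n / 2) ≤ m * 2 ^ r :=
  Iff.rfl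

/-- Every generator is a diagonal torus substitution with non-zero entries. [folklore] -/
theorem exists_diag_of_mem_torusGens {n r : ℕ} {Λ : Fin r → (Fin n ⊕ Fin n) → ℤ}
    {γ : GL (Fin n × Fin n) ℂ} (hγ : γ ∈ torusGens n r Λ) :
    ∃ d e : Fin n → ℂ, (∀ k, d k ≠ 0) ∧ (∀ l, e l ≠ 0) ∧
      (γ : Matrix (Fin n × Fin n) (Fin n × Fin n) ℂ) = Matrix.diagonal (fun p => d p.1 * e p.2) := by
  obtain ⟨d, e, -, hγ⟩ := hγ
  exact ⟨fun k => (d k : ℂ), fun l => (e l : ℂ), fun k => (d k).ne_zero, fun l => (e l).ne_zero, hγ⟩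

/-- At `r = 0` the generator set is the full row–column torus of `RigidMinimalReps.TorusBound`
(stmt-5114): every `diag(d_k e_l)` with `d_k, e_l ≠ 0` is a generator. [folklore] -/
theorem twoSidedGens_subset_torusGens (n : ℕ) (Λ : Fin 0 → (Fin n ⊕ Fin n) → ℤ) :
    {γ : Matrix.GeneralLinearGroup (Fin n × Fin n) ℂ | ∃ d e : Fin n → ℂ, (∀ i, d i ≠ 0) ∧
        (∀ j, e j ≠ 0) ∧
        (γ : Matrix (Fin n × Fin n) (Fin n × Fin n) ℂ) = Matrix.diagonal (fun p => d p.1 * e p.2)} ⊆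
      torusGens n 0 Λ := by
  rintro γ ⟨d, e, hd, he, hγ⟩
  refine ⟨fun k => Units.mk0 (d k) (hd k), fun l => Units.mk0 (e l) (he l), fun i => Fin.elim0 i, ?_⟩
  simpa using hγ

/-- Semi-invariance of the permanent under the row–column torus:
`per(d_k e_l x_{kl}) = (∏ d)(∏ e) · per(x)`. [folklore] -/
theorem linSubst_torus_perPoly {n : ℕ} (d e : Fin n → ℂ) :
    linSubst (Fin n × Fin n) ℂ (Matrix.diagonal fun p : Fin n × Fin n => d p.1 * e p.2)
      (perPoly (Fin n) ℂ) = C ((∏ k, d k) * ∏ l, e l) * perPoly (Fin n) ℂ := by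
  rw [perPoly_eq_sum, map_sum, Finset.mul_sum]
  refine Finset.sum_congr rfl fun σ _ => ?_
  rw [map_prod]
  simp_rw [Grenet.linSubst_diagonal_X, MvPolynomial.smul_eq_C_mul, Finset.prod_mul_distrib, ← map_prod]
  congr 2
  rw [Finset.prod_mul_distrib]
  congr 1
  exact Equiv.prod_comp σ d

/-- Exact lifts compose: lifts on a generating set give lifts on the generated subgroup (the closure
induction of `IsEquivariantDetRepr.of_generators`, which does not use its affine conjunct).
[cite: LandsbergRessayre2017, Def. 1.3] -/
theorem lifts_of_generators {n m : ℕ} {S : Set (GL (Fin n × Fin n) ℂ)}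
    (A : Matrix (Fin m) (Fin m) (MvPolynomial (Fin n × Fin n) ℂ))
    (hS : ∀ γ ∈ S, ∃ g h : GL (Fin m) ℂ,
      Matrix.linSubstEntries γ A =
        (g : Matrix (Fin m) (Fin m) ℂ).map C * A * ((h⁻¹ : GL (Fin m) ℂ) : Matrix (Fin m) (Fin m) ℂ).map C) :
    ∀ γ ∈ Subgroup.closure S, ∃ g h : GL (Fin m) ℂ,
      Matrix.linSubstEntries γ A =
        (g : Matrix (Fin m) (Fin m) ℂ).map C * A * ((h⁻¹ : GL (Fin m) ℂ) : Matrix (Fin m) (Fin m) ℂ).map C := by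
  intro γ hγ
  induction hγ using Subgroup.closure_induction with
  | mem x hx => exact hS x hx
  | one =>
    refine ⟨1, 1, ?_⟩
    simp [Matrix.map_one C C_0 C_1]
  | mul x y _ _ hx hy =>
    obtain ⟨g₁, h₁, h1⟩ := hx
    obtain ⟨g₂, h₂, h2⟩ := hy
    refine ⟨g₂ * g₁, h₂ * h₁, ?_⟩
    rw [← Matrix.linSubstEntries_linSubstEntries, h2, Matrix.linSubstEntries_mul,
      Matrix.linSubstEntries_mul, Matrix.linSubstEntries_map_C, Matrix.linSubstEntries_map_C, h1,
      _root_.mul_inv_rev, Units.val_mul, Units.val_mul, Matrix.map_mul, Matrix.map_mul]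
    simp only [Matrix.mul_assoc]
  | inv x _ hx =>
    obtain ⟨g, h, h1⟩ := hx
    refine ⟨g⁻¹, h⁻¹, ?_⟩
    have key : A = (g : Matrix (Fin m) (Fin m) ℂ).map C * Matrix.linSubstEntries x⁻¹ A *
        ((h⁻¹ : GL (Fin m) ℂ) : Matrix (Fin m) (Fin m) ℂ).map C := by
      have := congrArg (Matrix.linSubstEntries x⁻¹) h1
      rwa [Matrix.linSubstEntries_inv_linSubstEntries, Matrix.linSubstEntries_mul,
        Matrix.linSubstEntries_mul, Matrix.linSubstEntries_map_C, Matrix.linSubstEntries_map_C] at this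
    rw [inv_inv]
    have hGL : ∀ u : GL (Fin m) ℂ, ((u⁻¹ : GL (Fin m) ℂ) : Matrix (Fin m) (Fin m) ℂ).map
        (C : ℂ →+* MvPolynomial (Fin n × Fin n) ℂ) *
        (u : Matrix (Fin m) (Fin m) ℂ).map (C : ℂ →+* MvPolynomial (Fin n × Fin n) ℂ) = 1 :=
      fun u => by
        rw [← Matrix.map_mul, ← Units.val_mul, inv_mul_cancel, Units.val_one, Matrix.map_one C C_0 C_1]
    have hg := hGL g
    have hh := hGL h
    calc Matrix.linSubstEntries x⁻¹ A
        = (((g⁻¹ : GL (Fin m) ℂ) : Matrix (Fin m) (Fin m) ℂ).map C * (g : Matrix (Fin m) (Fin m) ℂ).map C) *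
            Matrix.linSubstEntries x⁻¹ A * (((h⁻¹ : GL (Fin m) ℂ) : Matrix (Fin m) (Fin m) ℂ).map C *
              (h : Matrix (Fin m) (Fin m) ℂ).map C) := by rw [hg, hh, Matrix.one_mul, Matrix.mul_one]
      _ = ((g⁻¹ : GL (Fin m) ℂ) : Matrix (Fin m) (Fin m) ℂ).map C * ((g : Matrix (Fin m) (Fin m) ℂ).map C *
            Matrix.linSubstEntries x⁻¹ A * ((h⁻¹ : GL (Fin m) ℂ) : Matrix (Fin m) (Fin m) ℂ).map C) *
            (h : Matrix (Fin m) (Fin m) ℂ).map C := by simp only [Matrix.mul_assoc]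
      _ = ((g⁻¹ : GL (Fin m) ℂ) : Matrix (Fin m) (Fin m) ℂ).map C * A * (h : Matrix (Fin m) (Fin m) ℂ).map C := by
          rw [← key]

/-! ## §A Load-bearing analysis -/

/-! ### (A1) the guard `3 ≤ n` -/

/-- The crux with the guard `3 ≤ n` dropped. [folklore] -/
def SubtorusCoveringWithoutNGe : Prop :=
  ∀ (n m r : ℕ) (Λ : Fin r → (Fin n ⊕ Fin n) → ℤ)
    (B : Matrix (Fin m) (Fin m) (MvPolynomial (Fin n × Fin n) ℂ)), Admissible Λ →
    IsEquivariantDetRepr (Subgroup.closure (torusGens n r Λ)) (perPoly (Fin n) ℂ) B →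
    Nat.choose n (n / 2) ≤ m * 2 ^ r

/-- `per_0 = 1` (one permutation, empty product). [folklore] -/
theorem perPoly_fin_zero : perPoly (Fin 0) ℂ = 1 := by
  rw [perPoly_eq_sum]; simp

/-- **Any proof must use the guard — but only to exclude `n = 0`:** the empty matrix is an (equivariant,
affine) determinantal representation of `per_0 = 1` of size `m = 0`, and `C(0,0) = 1 > 0`.  At
`n = 1, 2` the `C(n,⌊n/2⌋)`-form holds (degree forces `m ≥ n ≥ C(n,⌊n/2⌋)`). [folklore] -/
theorem subtorusCovering_false_without_nGe : ¬ SubtorusCoveringWithoutNGe := by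
  intro h
  have key := h 0 0 0 (fun i => Fin.elim0 i) (Matrix.of fun i _ => Fin.elim0 i) (fun i => Fin.elim0 i)
    ⟨⟨fun i _ => Fin.elim0 i, by rw [Matrix.det_isEmpty, perPoly_fin_zero]⟩,
      fun γ _ => ⟨1, 1, Matrix.ext fun i _ => Fin.elim0 i⟩⟩
  simp at key

/-! ### (A2) affineness of the entries -/

/-- The crux with `totalDegree ≤ 1` dropped from `IsEquivariantDetRepr` (determinantal EXPRESSIONS of any
degree, still with exact lifts). [folklore] -/
def SubtorusCoveringWithoutAffine : Prop :=
  ∀ n : ℕ, 3 ≤ n → ∀ (m r : ℕ) (Λ : Fin r → (Fin n ⊕ Fin n) → ℤ)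
    (B : Matrix (Fin m) (Fin m) (MvPolynomial (Fin n × Fin n) ℂ)), Admissible Λ →
    (B.det = perPoly (Fin n) ℂ ∧
      ∀ γ ∈ Subgroup.closure (torusGens n r Λ), ∃ g h : GL (Fin m) ℂ,
        Matrix.linSubstEntries γ B =
          (g : Matrix (Fin m) (Fin m) ℂ).map C * B * ((h⁻¹ : GL (Fin m) ℂ) : Matrix (Fin m) (Fin m) ℂ).map C) →
    Nat.choose n (n / 2) ≤ m * 2 ^ r

/-- The `1 × 1` matrix `(per_n)`. [folklore] -/
def perOne (n : ℕ) : Matrix (Fin 1) (Fin 1) (MvPolynomial (Fin n × Fin n) ℂ) :=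
  Matrix.of fun _ _ => perPoly (Fin n) ℂ

/-- `(per_n)` has exact lifts of the whole row–column torus, a fortiori of every `T_Λ`:
`g = (∏ d ∏ e)`, `h = 1`. [folklore] -/
theorem perOne_lifts (n r : ℕ) (Λ : Fin r → (Fin n ⊕ Fin n) → ℤ) :
    ∀ γ ∈ Subgroup.closure (torusGens n r Λ), ∃ g h : GL (Fin 1) ℂ,
      Matrix.linSubstEntries γ (perOne n) =
        (g : Matrix (Fin 1) (Fin 1) ℂ).map C * perOne n *
          ((h⁻¹ : GL (Fin 1) ℂ) : Matrix (Fin 1) (Fin 1) ℂ).map C := by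
  refine lifts_of_generators (perOne n) fun γ hγ => ?_
  obtain ⟨d, e, hd, he, hγ⟩ := exists_diag_of_mem_torusGens hγ
  have hc : (∏ k, d k) * ∏ l, e l ≠ 0 :=
    mul_ne_zero (Finset.prod_ne_zero_iff.2 fun k _ => hd k) (Finset.prod_ne_zero_iff.2 fun l _ => he l)
  refine ⟨Grenet.diagUnit (fun _ => (∏ k, d k) * ∏ l, e l) (fun _ => hc), 1, ?_⟩
  ext i j
  fin_cases i; fin_cases j
  simp [perOne, Matrix.linSubstEntries_apply, hγ, linSubst_torus_perPoly, Matrix.map_one C C_0 C_1,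
    Matrix.mul_apply]

/-- **Any proof must use affineness:** without `totalDegree ≤ 1`, the `1 × 1` expression `(per_3)` is
`T_Λ`-equivariant of size `1 < 3 = C(3,1)` (here `r = 0`, `Λ` empty). [folklore] -/
theorem subtorusCovering_false_without_affine : ¬ SubtorusCoveringWithoutAffine := by
  intro h
  have key := h 3 le_rfl 1 0 (fun i => Fin.elim0 i) (perOne 3) (fun i => Fin.elim0 i)
    ⟨by simp [perOne, Matrix.det_unique], perOne_lifts 3 0 _⟩
  simp at key

/-! ### (A3) `per_n` itself (regularity): the same statement for `det_n` is false -/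

/-- The crux with `per_n` replaced by `det_n`. [folklore] -/
def SubtorusCoveringForDet : Prop :=
  ∀ n : ℕ, 3 ≤ n → ∀ (m r : ℕ) (Λ : Fin r → (Fin n ⊕ Fin n) → ℤ)
    (B : Matrix (Fin m) (Fin m) (MvPolynomial (Fin n × Fin n) ℂ)), Admissible Λ →
    IsEquivariantDetRepr (Subgroup.closure (torusGens n r Λ)) (detPoly (Fin n) ℂ) B →
    Nat.choose n (n / 2) ≤ m * 2 ^ r

attribute [-simp] Literature.Computability.AlgebraicComplexity.linSubst_X in
/-- `A(X) = X` is a fully torus-equivariant affine representation of `det_n` (lifts `g = diag d`,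
`h⁻¹ = diag e`), for every `T_Λ`. [cite: LandsbergRessayre2017, §2] -/
theorem isEquivariantDetRepr_mvPolynomialX (n r : ℕ) (Λ : Fin r → (Fin n ⊕ Fin n) → ℤ) :
    IsEquivariantDetRepr (Subgroup.closure (torusGens n r Λ)) (detPoly (Fin n) ℂ)
      (Matrix.mvPolynomialX (Fin n) (Fin n) ℂ) := by
  refine IsEquivariantDetRepr.of_generators ⟨fun i j => ?_, rfl⟩ fun γ hγ => ?_
  · rw [Matrix.mvPolynomialX_apply, totalDegree_X]
  obtain ⟨d, e, hd, he, hγ⟩ := exists_diag_of_mem_torusGens hγ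
  refine ⟨Grenet.diagUnit d hd, (Grenet.diagUnit e he)⁻¹, ?_⟩
  rw [inv_inv, Grenet.val_diagUnit, Grenet.val_diagUnit, Matrix.diagonal_map (map_zero C),
    Matrix.diagonal_map (map_zero C)]
  refine Matrix.ext fun i j => ?_
  rw [Matrix.linSubstEntries_apply, Matrix.mul_diagonal, Matrix.diagonal_mul, hγ,
    Matrix.mvPolynomialX_apply, Grenet.linSubst_diagonal_X, MvPolynomial.smul_eq_C_mul]
  simp only [map_mul]
  ring

/-- **Any proof must use a `per`-specific input** (in the line: von zur Gathen regularity
`rank B(0) = m - 1`, false for the irregular `X`, `X(0) = 0`): for `det_5` the fully torus-equivariant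
`X` has size `5 < 10 = C(5,2)` — `edc_T(det_m) = m` (LR17). [cite: LandsbergRessayre2017, §2] -/
theorem subtorusCovering_false_for_detPoly : ¬ SubtorusCoveringForDet := by
  intro h
  have key := h 5 (by norm_num) 5 0 (fun i => Fin.elim0 i) (Matrix.mvPolynomialX (Fin 5) (Fin 5) ℂ)
    (fun i => Fin.elim0 i) (isEquivariantDetRepr_mvPolynomialX 5 0 _)
  simp [Nat.choose] at key

/-! ### (A4) equivariance: dropping it leaves an OPEN statement -/

/-- The crux with equivariance dropped (its `r = 0` reading): plain affine representations. [folklore] -/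
def SubtorusCoveringWithoutEquivariance : Prop :=
  ∀ n : ℕ, 3 ≤ n → ∀ (m : ℕ) (B : Matrix (Fin m) (Fin m) (MvPolynomial (Fin n × Fin n) ℂ)),
    IsAffineDetRepr (perPoly (Fin n) ℂ) B → Nat.choose n (n / 2) ≤ m

/-- **Without equivariance the crux IS the super-quadratic lower bound `C(n,⌊n/2⌋) ≤ dc(per_n)`** —
open (Mignon–Ressayre give `n²/2`; `C(n,⌊n/2⌋) > n²/2` from `n = 6`).  Neither refutable nor provable
here; recorded so that nobody mistakes the equivariance for decoration. [cite: MignonRessayre2004, §1] -/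
theorem subtorusCoveringWithoutEquivariance_iff :
    SubtorusCoveringWithoutEquivariance ↔
      ∀ n : ℕ, 3 ≤ n → Nat.choose n (n / 2) ≤ determinantalComplexity (perPoly (Fin n) ℂ) := by
  constructor
  · intro h n hn
    obtain ⟨A, hA⟩ := hasDetRepr_determinantalComplexity_holds (perPoly (Fin n) ℂ)
    exact h n hn _ A hA
  · intro h n hn m B hB
    exact (h n hn).trans (determinantalComplexity_le_of_hasDetRepr ⟨B, hB⟩)

/-! ### (A5) admissibility — remark only
No counterexample to the admissibility-free statement is constructible: `T_Λ` has codimension `≤ r`, so a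
witness still needs `m · 2^r < C(n,⌊n/2⌋)`, below Grenet.  On paper the dictionary of §C uses only the ROW
half (pointedness ⇒ no closed weight walk); the column half is redundant — possibly unnecessary hypothesis. -/

/-! ## §B Natural strengthenings -/

/-- `per_2` as a `2 × 2` determinant: `[[x₀₀, -x₁₀], [x₀₁, x₁₁]]` (irregular: constant part `0`). [folklore] -/
def perTwo : Matrix (Fin 2) (Fin 2) (MvPolynomial (Fin 2 × Fin 2) ℂ) :=
  !![X (0, 0), -X (1, 0); X (0, 1), X (1, 1)]

/-- `per_2 = x₀₀ x₁₁ + x₁₀ x₀₁`. [folklore] -/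
theorem perPoly_fin_two : perPoly (Fin 2) ℂ = X (0, 0) * X (1, 1) + X (1, 0) * X (0, 1) := by
  rw [perPoly, Matrix.permanent_fin_two_row]
  simp only [Matrix.mvPolynomialX_apply]
  ring

/-- `det perTwo = per_2`. [folklore] -/
theorem det_perTwo : perTwo.det = perPoly (Fin 2) ℂ := by
  rw [perTwo, Matrix.det_fin_two_of, perPoly_fin_two]; ring

/-- `perTwo` is an affine determinantal representation of `per_2` (size 2 = dc(per_2)). [folklore] -/
theorem isAffineDetRepr_perTwo : IsAffineDetRepr (perPoly (Fin 2) ℂ) perTwo := by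
  refine ⟨fun i j => ?_, det_perTwo⟩
  fin_cases i <;> fin_cases j <;>
    simp [perTwo, totalDegree_X, totalDegree_neg]

attribute [-simp] Literature.Computability.AlgebraicComplexity.linSubst_X in
/-- `perTwo` has exact lifts of the whole row–column torus (`g = diag e`, `h⁻¹ = diag d`), hence of
every `T_Λ`. [folklore] -/
theorem isEquivariantDetRepr_perTwo (r : ℕ) (Λ : Fin r → (Fin 2 ⊕ Fin 2) → ℤ) :
    IsEquivariantDetRepr (Subgroup.closure (torusGens 2 r Λ)) (perPoly (Fin 2) ℂ) perTwo := by
  refine IsEquivariantDetRepr.of_generators isAffineDetRepr_perTwo fun γ hγ => ?_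
  obtain ⟨d, e, hd, he, hγ⟩ := exists_diag_of_mem_torusGens hγ
  refine ⟨Grenet.diagUnit e he, (Grenet.diagUnit d hd)⁻¹, ?_⟩
  rw [inv_inv, Grenet.val_diagUnit, Grenet.val_diagUnit, Matrix.diagonal_map (map_zero C),
    Matrix.diagonal_map (map_zero C)]
  refine Matrix.ext fun i j => ?_
  rw [Matrix.linSubstEntries_apply, Matrix.mul_diagonal, Matrix.diagonal_mul, hγ]
  fin_cases i <;> fin_cases j <;>
    simp only [perTwo, Matrix.of_apply, Matrix.cons_val', Matrix.cons_val_zero, Matrix.cons_val_one,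
      Matrix.empty_val', Matrix.cons_val_fin_one, map_neg,
      Grenet.linSubst_diagonal_X, MvPolynomial.smul_eq_C_mul, map_mul,
      Fin.zero_eta, Fin.mk_one, Fin.isValue] <;> ring

/-- **The Grenet form needs the guard:** `2^n - 1 ≤ m · 2^r` (what the covering argument gives for
`n ≥ 3`, summed over all levels) is FALSE at `n = 2`: `perTwo` is fully torus-equivariant of size
`2 < 3`.  (The crux's own form survives there: `C(2,1) = 2 ≤ 2`.)  Regularity is what fails at `n = 2`.
[cite: LandsbergRessayre2017, Thm. 2.8] -/
theorem not_grenetForm_without_nGe :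
    ¬ ∀ (n m r : ℕ) (Λ : Fin r → (Fin n ⊕ Fin n) → ℤ)
      (B : Matrix (Fin m) (Fin m) (MvPolynomial (Fin n × Fin n) ℂ)), Admissible Λ →
      IsEquivariantDetRepr (Subgroup.closure (torusGens n r Λ)) (perPoly (Fin n) ℂ) B →
      2 ^ n - 1 ≤ m * 2 ^ r := by
  intro h
  have key := h 2 2 0 (fun i => Fin.elim0 i) perTwo (fun i => Fin.elim0 i) (isEquivariantDetRepr_perTwo 0 _)
  norm_num at key

/-- **The `r = 0` slice is a theorem, in Grenet form:** a representation with exact lifts of the FULL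
row–column torus has `2^n - 1 ≤ m` (`RigidMinimalRepsTorusBound.torusBound_proof`, stmt-5114, whose
generator set is contained in `torusGens n 0 Λ`).  No counterexample with `Λ` empty exists.
[cite: LandsbergRessayre2017, Thm. 2.8] -/
theorem subtorusCovering_rank_zero (n : ℕ) (hn : 3 ≤ n) (m : ℕ) (Λ : Fin 0 → (Fin n ⊕ Fin n) → ℤ)
    (B : Matrix (Fin m) (Fin m) (MvPolynomial (Fin n × Fin n) ℂ))
    (hB : IsEquivariantDetRepr (Subgroup.closure (torusGens n 0 Λ)) (perPoly (Fin n) ℂ) B) :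
    2 ^ n - 1 ≤ m := by
  have h := _root_.Summit.ValiantsHypothesis.ValiantsHypothesis.Theorems.RigidMinimalRepsTorusBound.torusBound_proof
  unfold Summit.ValiantsHypothesis.ValiantsHypothesis.Theses.RigidMinimalReps.TorusBound at h
  exact h n hn m B (hB.anti (Subgroup.closure_mono (twoSidedGens_subset_torusGens n Λ)))

/-- `C(n,⌊n/2⌋) ≤ 2^n - 1` for `n ≥ 2` (the middle coefficient is not the only one). [folklore] -/
theorem choose_middle_le_two_pow_sub_one {n : ℕ} (hn : 2 ≤ n) : Nat.choose n (n / 2) ≤ 2 ^ n - 1 := by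
  have h0 : (0 : ℕ) ≠ n / 2 := by omega
  have hsub : ({0, n / 2} : Finset ℕ) ⊆ Finset.range (n + 1) := by
    intro k hk
    simp only [Finset.mem_insert, Finset.mem_singleton] at hk
    simp only [Finset.mem_range]
    omega
  have h := Finset.sum_le_sum_of_subset (f := fun k => Nat.choose n k) hsub
  rw [Finset.sum_pair h0, Nat.sum_range_choose, Nat.choose_zero_right] at h
  omega

/-- Hence the crux at `r = 0`, with room to spare. [cite: LandsbergRessayre2017, Thm. 2.8] -/
theorem subtorusCovering_r_zero (n : ℕ) (hn : 3 ≤ n) (m : ℕ) (Λ : Fin 0 → (Fin n ⊕ Fin n) → ℤ)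
    (B : Matrix (Fin m) (Fin m) (MvPolynomial (Fin n × Fin n) ℂ))
    (hB : IsEquivariantDetRepr (Subgroup.closure (torusGens n 0 Λ)) (perPoly (Fin n) ℂ) B) :
    Nat.choose n (n / 2) ≤ m * 2 ^ 0 := by
  have h1 := subtorusCovering_rank_zero n hn m Λ B hB
  have h2 := choose_middle_le_two_pow_sub_one (n := n) (by omega)
  simpa using h2.trans h1

/-! ## §C Why it resists — pre-attack on the registered line `Lines/birth.lean`

Paper check of the three registered stubs (all TRUE; no target this cycle):
* `stub_genericElement`: a generic point of `T_Λ°` (e.g. `exp` of a rationally generic real vector in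
  `Λ^⊥`) satisfies (i) and (iii) for ANY `Λ`; (ii) follows from (iii) + zero ROW-sums.  Junk `n = 0`:
  `u ≠ 0` impossible, fine.
* `stub_pathWeights`: adapted bases (`f₁ = ker Λ₀` of `h`-weight `γ₀`, `e_i = Λ₀ f_i` for `i ≥ 2`,
  `e₁ ∈ gen_g(γ₁) ∖ im Λ₀`), intertwining `B_p : gen_h(μ) → gen_g(c_p μ)`, no closed walk ⇒ acyclic
  support off index 1 and `B_ii = 1` ⇒ Leibniz = signed path sum; coefficient `κ ≠ 0` of `x_σ` ⇒ a
  length-`n` path spelling `x_σ`; its `i`-th vertex certifies `gen_g(γ₀ ∏_{k∈I} c_{k,σ k}) ≠ ⊥`, `|I| = i`,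
  for EVERY `1 ≤ i ≤ n` (at `i = n` it is `e₁`).  Junk: `m = 0` forces `det = 1 ≠ per_n` (`n ≥ 1`) or
  `n = 0` (conclusion vacuous); `γ₀` is pinned by `ker Λ₀ ≤ gen_h(γ₀)` since the kernel is a line.
* `stub_levelCount`: needs NO admissibility — exact separation puts equal-valued pairs in one translate of
  `ℚΛ` (`≤ 2^r` points, Odlyzko over `ℚ`), distinct values are distinct eigenvalues with independent
  non-zero generalised eigenspaces (`≤ m`), each pair serves `(n/2)!(n-n/2)!` permutations.  Junk `m = 0`:
  hypothesis unsatisfiable (`Perm (Fin n)` non-empty, `ℂ^0` has only `⊥`).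
So the stub set is jointly sufficient (`SubtorusCovering_of` is kernel-checked) and individually true:
nothing for the disprover to break on this line; a future `-- Targets` section starts here. -/

end Summit.ValiantsHypothesis.ValiantsHypothesis.Cruxes.SubtorusCovering.Disproof

end
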